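import Summits.NavierStokesRegularity.NavierStokesRegularity.Theorems.ExtremiserTransienceNearExtremalTransienceExtremiserLiouvilleConstantSpeedCalculus
import Literature.Analysis.FluidPDE.WholeSpaceIBP
import Literature.Analysis.FluidPDE.WholeSpaceIBPIntegrable
import Literature.Analysis.FluidPDE.AxisymHouLiVariables
import HarnessLib

/-!
# Crux `ExtremiserTransience.NearExtremalTransience` (stmt-NavierStokesRegularity-21883), line `extremiser_liouville`,
# stub K1b — THE GENERATOR OF THE PIOLA SLIDE and the axial integration-by-parts rule

`--supports stmt-NavierStokesRegularity-21883` (helper).  Author: prover seat `ns-el-k1b` (g8).  Record: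
`Cruxes/NearExtremalTransience/Lines/extremiser_liouville_k1b_slide.md` (§1–2).  Continues `…ConstantSpeedPiolaSlide`.

The infinitesimal generator of the vertical Piola slide `Ṽ_ε = (τ_ε′V_h, V₂)∘Φ_ε`, `τ_ε = id − εg`, is `−φ_g` with
```
  φ_g(x) = g(x₂)·∂₂V(x) + g′(x₂)·V_h(x),      V_h = V − V₂e₂ .
```
* `isDivFree_slideGenerator` : **`div φ_g = 0`** for `V ∈ C²` divergence free (`div ∂₂V = ∂₂ div V = 0`, `div(g′V_h) = −div((g′V₂)e₂) + …`);
* `inner_slideGenerator` : **`⟪c + V(x), φ_g(x)⟫ = g′(x₂)·(‖V(x)‖² − V₂(x)²) = g′(x₂)‖V_h(x)‖²`** for a constant-speed `w = c + V`,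
  `c = (0,0,c₂)` (`⟪w, ∂₂w⟫ = 0`, `⟪c, V_h⟫ = 0`) — so `−φ_g` is an inward (speed-non-increasing) direction to first order wherever
  `g′ ≥ 0`, which is the infinitesimal form of `…PiolaSlide.norm_add_piolaSlide_le`;
* `integral_axialWeight_inner_fderiv_eq` : the AXIAL INTEGRATION-BY-PARTS RULE used for every `x₂`-weighted identity of the
  record: **`∫ g(x₂)⟪F, ∂₂F⟫ = −½∫ g′(x₂)‖F‖²`** for `F ∈ C¹ ∩ L²` with `‖F‖·‖∂₂F‖ ∈ L¹` and `g, g′` bounded (divergence theorem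
  for the integrable field `(g(x₂)‖F‖²)·e₂`, tree `integral_divergence_eq_zero_of_integrable`).  With `F = curl V` this is
  `∫g⟪ω, ∂₂ω⟫ = −½∫g′‖ω‖²`, the first term of `a₁(φ_g)` (record §2 (A)).

WHAT THIS IS NOT: K1b is NOT proved; nothing here proves NS regularity. [folklore]
-/

noncomputable section

open Set Filter Topology MeasureTheory Metric Function InnerProductSpace
open scoped ENNReal NNReal Topology InnerProductSpace RealInnerProductSpace ContDiff
open Literature.Analysis.FluidPDE Literature.Analysis

namespace Summit.NavierStokesRegularity.NavierStokesRegularity.Theorems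

-- the problem directory repeats the summit name (`NavierStokesRegularity/NavierStokesRegularity`)
set_option linter.dupNamespace false

namespace ExtremiserLiouville

open DepletionLadder.KStar

variable {V F : EuclideanSpace ℝ (Fin 3) → EuclideanSpace ℝ (Fin 3)} {c : EuclideanSpace ℝ (Fin 3)} {g : ℝ → ℝ}

/-! ## 1. The generator is divergence free -/

/-- Derivative of an axial re-parametrisation `x ↦ τ(xᵢ)`: `D(τ∘xᵢ)(x) = τ′(xᵢ)·dxᵢ`. [folklore] -/
theorem hasFDerivAt_comp_coord {τ : ℝ → ℝ} (hτ : Differentiable ℝ τ) (i : Fin 3) (x : EuclideanSpace ℝ (Fin 3)) :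
    HasFDerivAt (fun y : EuclideanSpace ℝ (Fin 3) => τ (y i))
      (deriv τ (x i) • (EuclideanSpace.proj i : EuclideanSpace ℝ (Fin 3) →L[ℝ] ℝ)) x := by
  have h := (hτ (x i)).hasDerivAt.comp_hasFDerivAt x
    (EuclideanSpace.proj i : EuclideanSpace ℝ (Fin 3) →L[ℝ] ℝ).hasFDerivAt
  exact h

/-- Components of derivatives: `(D(y ↦ F y i) x) v = (DF(x) v) i`. [folklore] -/
theorem fderiv_coord_apply {x : EuclideanSpace ℝ (Fin 3)} (hF : DifferentiableAt ℝ F x) (i : Fin 3)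
    (v : EuclideanSpace ℝ (Fin 3)) :
    fderiv ℝ (fun y => F y i) x v = fderiv ℝ F x v i := by
  have h : HasFDerivAt (fun y => F y i)
      ((EuclideanSpace.proj i : EuclideanSpace ℝ (Fin 3) →L[ℝ] ℝ).comp (fderiv ℝ F x)) x :=
    (EuclideanSpace.proj i : EuclideanSpace ℝ (Fin 3) →L[ℝ] ℝ).hasFDerivAt.comp x hF.hasFDerivAt
  rw [h.fderiv]
  rfl

/-- **`div ∂₂V = 0`** for a divergence-free `V ∈ C²` (mixed partials commute). [folklore] -/
theorem divergence_fderiv_apply_eq_zero (hV : ContDiff ℝ 2 V) (hdiv : VectorCalculus.IsDivFree V)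
    (x : EuclideanSpace ℝ (Fin 3)) :
    VectorCalculus.divergence (fun y => fderiv ℝ V y (EuclideanSpace.single (2 : Fin 3) (1 : ℝ))) x = 0 := by
  set e₂ : EuclideanSpace ℝ (Fin 3) := EuclideanSpace.single (2 : Fin 3) (1 : ℝ) with he₂
  have hd2 : Differentiable ℝ (fun y => fderiv ℝ V y e₂) :=
    ((hV.fderiv_right (m := 1) (by norm_num)).differentiable one_ne_zero).clm_apply (differentiable_const e₂)
  have hdi : ∀ i : Fin 3, Differentiable ℝ fun y => fderiv ℝ V y (EuclideanSpace.single i (1 : ℝ)) := fun i =>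
    ((hV.fderiv_right (m := 1) (by norm_num)).differentiable one_ne_zero).clm_apply (differentiable_const _)
  rw [divergence_eq_sum_three]
  have hc : ∀ i : Fin 3, fderiv ℝ (fun y => fderiv ℝ V y e₂) x (EuclideanSpace.single i (1 : ℝ)) i =
      fderiv ℝ (fun y => fderiv ℝ V y (EuclideanSpace.single i (1 : ℝ)) i) x e₂ := by
    intro i
    rw [fderiv_fderiv_apply_comm_vec hV x e₂ (EuclideanSpace.single i (1 : ℝ)),
      fderiv_coord_apply ((hdi i) x) i e₂]
  rw [hc 0, hc 1, hc 2]
  exact fderiv_divergence_components_eq_zero hV hdiv x e₂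

/-- **The generator of the Piola slide is divergence free**: for `V ∈ C²` with `div V = 0` and `g ∈ C²`,
`div( g(x₂)·∂₂V + g′(x₂)·(V − V₂e₂) ) = 0`. [folklore] -/
theorem isDivFree_slideGenerator (hV : ContDiff ℝ 2 V) (hdiv : VectorCalculus.IsDivFree V) (hg : ContDiff ℝ 2 g) :
    VectorCalculus.IsDivFree fun x : EuclideanSpace ℝ (Fin 3) =>
      g (x 2) • fderiv ℝ V x (EuclideanSpace.single (2 : Fin 3) (1 : ℝ)) +
        deriv g (x 2) • (V x - (V x 2) • EuclideanSpace.single (2 : Fin 3) (1 : ℝ)) := by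
  set e₂ : EuclideanSpace ℝ (Fin 3) := EuclideanSpace.single (2 : Fin 3) (1 : ℝ) with he₂
  have hVd : Differentiable ℝ V := hV.differentiable two_ne_zero
  have hgd : Differentiable ℝ g := hg.differentiable two_ne_zero
  have hg'c : ContDiff ℝ 1 (deriv g) := by
    have h2 : ContDiff ℝ (1 + 1) g := by rw [show ((1 : WithTop ℕ∞) + 1) = 2 by norm_num]; exact hg
    exact h2.deriv'
  have hg'd : Differentiable ℝ (deriv g) := hg'c.differentiable one_ne_zero
  -- the pieces
  set a : EuclideanSpace ℝ (Fin 3) → ℝ := fun y => g (y 2) with ha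
  set b : EuclideanSpace ℝ (Fin 3) → ℝ := fun y => deriv g (y 2) with hb
  set P : EuclideanSpace ℝ (Fin 3) → EuclideanSpace ℝ (Fin 3) := fun y => fderiv ℝ V y e₂ with hP
  have haD : ∀ y, HasFDerivAt a (deriv g (y 2) •
      (EuclideanSpace.proj (2 : Fin 3) : EuclideanSpace ℝ (Fin 3) →L[ℝ] ℝ)) y := fun y =>
    hasFDerivAt_comp_coord hgd 2 y
  have hbD : ∀ y, HasFDerivAt b (deriv (deriv g) (y 2) •
      (EuclideanSpace.proj (2 : Fin 3) : EuclideanSpace ℝ (Fin 3) →L[ℝ] ℝ)) y := fun y =>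
    hasFDerivAt_comp_coord hg'd 2 y
  have had : Differentiable ℝ a := fun y => (haD y).differentiableAt
  have hbd : Differentiable ℝ b := fun y => (hbD y).differentiableAt
  have hPd : Differentiable ℝ P :=
    ((hV.fderiv_right (m := 1) (by norm_num)).differentiable one_ne_zero).clm_apply (differentiable_const e₂)
  have hV2 : ∀ y, HasFDerivAt (fun z => V z 2)
      ((EuclideanSpace.proj (2 : Fin 3) : EuclideanSpace ℝ (Fin 3) →L[ℝ] ℝ).comp (fderiv ℝ V y)) y :=
    fun y => (EuclideanSpace.proj (2 : Fin 3) : EuclideanSpace ℝ (Fin 3) →L[ℝ] ℝ).hasFDerivAt.comp y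
      (hVd y).hasFDerivAt
  have hV2d : Differentiable ℝ fun z => V z 2 := fun y => (hV2 y).differentiableAt
  set s : EuclideanSpace ℝ (Fin 3) → ℝ := fun y => b y * V y 2 with hs
  have hsd : Differentiable ℝ s := hbd.mul hV2d
  intro x
  -- split: `φ = (a•P + b•V) + (−1)•(s•e₂)`
  have hsplit : (fun y : EuclideanSpace ℝ (Fin 3) => g (y 2) • fderiv ℝ V y e₂ + deriv g (y 2) • (V y - (V y 2) • e₂)) =
      fun y => (a y • P y + b y • V y) + (-1 : ℝ) • (s y • e₂) := by
    funext y
    simp only [ha, hb, hP, hs]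
    rw [smul_sub, smul_smul]
    module
  have h1d : Differentiable ℝ (fun y => a y • P y) := had.smul hPd
  have h2d : Differentiable ℝ (fun y => b y • V y) := hbd.smul hVd
  have h12d : Differentiable ℝ (fun y => a y • P y + b y • V y) := h1d.add h2d
  have h3d : Differentiable ℝ (fun y => s y • e₂) := hsd.smul_const e₂
  rw [hsplit, divergence_add_smul h12d h3d]
  have h12 : VectorCalculus.divergence (fun y => a y • P y + b y • V y) x =
      VectorCalculus.divergence (fun y => a y • P y) x + 1 * VectorCalculus.divergence (fun y => b y • V y) x := by
    have e : (fun y => a y • P y + b y • V y) = fun y => a y • P y + (1 : ℝ) • (b y • V y) := by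
      funext y; rw [one_smul]
    rw [e, divergence_add_smul h1d h2d]
  rw [h12, one_mul, Literature.Analysis.FluidPDE.divergence_smul_apply (had x) (hPd x),
    Literature.Analysis.FluidPDE.divergence_smul_apply (hbd x) (hVd x),
    Literature.Analysis.FluidPDE.divergence_smul_apply (hsd x) (differentiableAt_const e₂)]
  -- `div P = 0`, `div V = 0`, `div e₂ = 0`
  have hdivP : VectorCalculus.divergence P x = 0 := divergence_fderiv_apply_eq_zero hV hdiv x
  have hdivconst : VectorCalculus.divergence (fun _ : EuclideanSpace ℝ (Fin 3) => e₂) x = 0 := by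
    rw [divergence_eq_sum_three]; simp
  rw [hdivP, hdiv x, hdivconst, mul_zero, mul_zero, mul_zero, zero_add, zero_add, zero_add]
  -- the three gradient pairings
  have hga : ⟪P x, gradient a x⟫ = deriv g (x 2) * P x 2 := by
    rw [real_inner_comm, gradient, InnerProductSpace.toDual_symm_apply, (haD x).fderiv]; rfl
  have hgb : ⟪V x, gradient b x⟫ = deriv (deriv g) (x 2) * V x 2 := by
    rw [real_inner_comm, gradient, InnerProductSpace.toDual_symm_apply, (hbD x).fderiv]; rfl
  have hgs : ⟪e₂, gradient s x⟫ = deriv (deriv g) (x 2) * V x 2 + deriv g (x 2) * P x 2 := by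
    rw [real_inner_comm, gradient, InnerProductSpace.toDual_symm_apply]
    have hm : HasFDerivAt (fun y => b y * V y 2)
        (b x • ((EuclideanSpace.proj (2 : Fin 3) : EuclideanSpace ℝ (Fin 3) →L[ℝ] ℝ).comp (fderiv ℝ V x)) +
          V x 2 • (deriv (deriv g) (x 2) • (EuclideanSpace.proj (2 : Fin 3) : EuclideanSpace ℝ (Fin 3) →L[ℝ] ℝ))) x :=
      (hbD x).mul (hV2 x)
    have hse : s = fun y => b y * V y 2 := rfl
    rw [hse, hm.fderiv]
    show b x * (fderiv ℝ V x e₂) 2 + V x 2 * (deriv (deriv g) (x 2) * e₂ 2) = _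
    have e2 : e₂ 2 = 1 := by rw [he₂]; simp
    rw [e2, mul_one]
    simp only [hb, hP]
    ring
  rw [hga, hgb, hgs]
  ring

/-! ## 2. The generator is an inward direction to first order: `⟪w, φ_g⟫ = g′‖V_h‖²` -/

/-- **`⟪c + V(x), g(x₂)∂₂V(x) + g′(x₂)V_h(x)⟫ = g′(x₂)·(‖V(x)‖² − V₂(x)²)`** for a constant-speed field `w = c + V`
(`‖c + V‖ ≡ M`, `c = (0,0,c₂)`). [folklore] -/
theorem inner_slideGenerator (hVd : Differentiable ℝ V) {M : ℝ} (hM : ∀ x, ‖c + V x‖ = M) (hc0 : c 0 = 0) (hc1 : c 1 = 0)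
    (g : ℝ → ℝ) (x : EuclideanSpace ℝ (Fin 3)) :
    ⟪c + V x, g (x 2) • fderiv ℝ V x (EuclideanSpace.single (2 : Fin 3) (1 : ℝ)) +
        deriv g (x 2) • (V x - (V x 2) • EuclideanSpace.single (2 : Fin 3) (1 : ℝ))⟫ =
      deriv g (x 2) * (‖V x‖ ^ 2 - (V x 2) ^ 2) := by
  -- `⟪w, ∂₂w⟫ = 0`
  have hwd : Differentiable ℝ fun y => c + V y := hVd.const_add c
  have h0 : ⟪c + V x, fderiv ℝ V x (EuclideanSpace.single (2 : Fin 3) (1 : ℝ))⟫ = 0 := by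
    have h := inner_fderiv_apply_eq_zero_of_norm_eq hwd hM x (EuclideanSpace.single (2 : Fin 3) (1 : ℝ))
    rwa [fderiv_const_add] at h
  -- `⟪c + V, V − V₂e₂⟫ = ‖V‖² − V₂²`
  have h1 : ⟪c + V x, V x - (V x 2) • EuclideanSpace.single (2 : Fin 3) (1 : ℝ)⟫ = ‖V x‖ ^ 2 - (V x 2) ^ 2 := by
    have hn : ‖V x‖ ^ 2 = V x 0 ^ 2 + V x 1 ^ 2 + V x 2 ^ 2 := by
      rw [EuclideanSpace.real_norm_sq_eq, Fin.sum_univ_three]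
    rw [hn]
    simp [PiLp.inner_apply, Fin.sum_univ_three, hc0, hc1]
    ring
  rw [inner_add_right, inner_smul_right, inner_smul_right, h0, h1, mul_zero, zero_add]

/-! ## 3. The axial integration-by-parts rule -/

/-- **Axial integration by parts**: for `F ∈ C¹(ℝ³;ℝ³)` with `‖F‖² ∈ L¹`, `‖F‖·‖∂₂F‖ ∈ L¹`, and `g ∈ C¹(ℝ)` with `g, g′`
bounded: `∫ g(x₂)⟪F(x), ∂₂F(x)⟫dx = −½ ∫ g′(x₂)‖F(x)‖²dx` (divergence theorem for the integrable `C¹` field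
`x ↦ (g(x₂)‖F(x)‖²)·e₂`). [folklore] -/
theorem integral_axialWeight_inner_fderiv_eq (hF : ContDiff ℝ 1 F)
    (hF2 : Integrable (fun x => ‖F x‖ ^ 2) volume)
    (hFD : Integrable (fun x => ‖F x‖ * ‖fderiv ℝ F x (EuclideanSpace.single (2 : Fin 3) (1 : ℝ))‖) volume)
    (hg : ContDiff ℝ 1 g) {K : ℝ} (hgK : ∀ s, |g s| ≤ K) (hg'K : ∀ s, |deriv g s| ≤ K) :
    (∫ x, g (x 2) * ⟪F x, fderiv ℝ F x (EuclideanSpace.single (2 : Fin 3) (1 : ℝ))⟫) =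
      -(1 / 2) * ∫ x, deriv g (x 2) * ‖F x‖ ^ 2 := by
  set e₂ : EuclideanSpace ℝ (Fin 3) := EuclideanSpace.single (2 : Fin 3) (1 : ℝ) with he₂
  have hFd : Differentiable ℝ F := hF.differentiable one_ne_zero
  have hgd : Differentiable ℝ g := hg.differentiable one_ne_zero
  have hK0 : 0 ≤ K := (abs_nonneg _).trans (hgK 0)
  -- the scalar `q(x) = g(x₂)‖F(x)‖²` and the field `Y = q • e₂`
  set a : EuclideanSpace ℝ (Fin 3) → ℝ := fun y => g (y 2) with ha
  set n : EuclideanSpace ℝ (Fin 3) → ℝ := fun y => ‖F y‖ ^ 2 with hn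
  have haD : ∀ y, HasFDerivAt a (deriv g (y 2) •
      (EuclideanSpace.proj (2 : Fin 3) : EuclideanSpace ℝ (Fin 3) →L[ℝ] ℝ)) y := fun y =>
    hasFDerivAt_comp_coord hgd 2 y
  have ha1 : ContDiff ℝ 1 a := by
    have : a = fun y => g ((EuclideanSpace.proj (2 : Fin 3) : EuclideanSpace ℝ (Fin 3) →L[ℝ] ℝ) y) := rfl
    rw [this]; exact hg.comp (EuclideanSpace.proj (2 : Fin 3) : EuclideanSpace ℝ (Fin 3) →L[ℝ] ℝ).contDiff
  have hnD : ∀ y, HasFDerivAt n (2 • (innerSL ℝ (F y)).comp (fderiv ℝ F y)) y := by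
    intro y
    have h := (hFd y).hasFDerivAt.norm_sq
    exact h
  have hn1 : ContDiff ℝ 1 n := by rw [hn]; exact hF.norm_sq ℝ
  have hq1 : ContDiff ℝ 1 fun y => a y * n y := ha1.mul hn1
  have hY1 : ContDiff ℝ 1 fun y => (a y * n y) • e₂ := hq1.smul contDiff_const
  -- integrability of `Y` and of `div Y`
  have cF : Continuous F := hF.continuous
  have hmeas_a : AEStronglyMeasurable a volume := ha1.continuous.aestronglyMeasurable
  have iY : Integrable (fun y => (a y * n y) • e₂) volume := by
    have i1 : Integrable (fun y => a y * n y) volume := by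
      refine (hF2.const_mul K).mono' (hmeas_a.mul hF2.aestronglyMeasurable) (Eventually.of_forall fun y => ?_)
      rw [Real.norm_eq_abs, abs_mul]
      have hny : |n y| = ‖F y‖ ^ 2 := by simp only [hn]; exact abs_of_nonneg (sq_nonneg _)
      rw [hny]
      exact mul_le_mul_of_nonneg_right (hgK _) (sq_nonneg _)
    exact i1.smul_const e₂
  have hdivY : ∀ y, VectorCalculus.divergence (fun z => (a z * n z) • e₂) y =
      deriv g (y 2) * ‖F y‖ ^ 2 + 2 * (g (y 2) * ⟪F y, fderiv ℝ F y e₂⟫) := by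
    intro y
    rw [Literature.Analysis.FluidPDE.divergence_smul_apply ((hq1.differentiable one_ne_zero) y) (differentiableAt_const e₂)]
    have hdivconst : VectorCalculus.divergence (fun _ : EuclideanSpace ℝ (Fin 3) => e₂) y = 0 := by
      rw [divergence_eq_sum_three]; simp
    rw [hdivconst, mul_zero, zero_add, real_inner_comm, gradient, InnerProductSpace.toDual_symm_apply]
    have hm : HasFDerivAt (fun z => a z * n z) (a y • (2 • (innerSL ℝ (F y)).comp (fderiv ℝ F y)) +
        n y • (deriv g (y 2) • (EuclideanSpace.proj (2 : Fin 3) : EuclideanSpace ℝ (Fin 3) →L[ℝ] ℝ))) y :=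
      (haD y).mul (hnD y)
    rw [hm.fderiv]
    show a y * ((2 : ℕ) • ⟪F y, fderiv ℝ F y e₂⟫) + n y * (deriv g (y 2) * e₂ 2) = _
    have e2 : e₂ 2 = 1 := by rw [he₂]; simp
    rw [e2, mul_one, nsmul_eq_mul]
    simp only [ha, hn]
    push_cast
    ring
  have i_main : Integrable (fun y => g (y 2) * ⟪F y, fderiv ℝ F y e₂⟫) volume := by
    refine (hFD.const_mul K).mono' ?_ (Eventually.of_forall fun y => ?_)
    · exact (ha1.continuous.mul ((cF.inner (𝕜 := ℝ) ((hF.continuous_fderiv one_ne_zero).clm_apply continuous_const)))).aestronglyMeasurable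
    · rw [Real.norm_eq_abs, abs_mul]
      calc |g (y 2)| * |⟪F y, fderiv ℝ F y e₂⟫| ≤ K * (‖F y‖ * ‖fderiv ℝ F y e₂‖) :=
            mul_le_mul (hgK _) (abs_real_inner_le_norm _ _) (abs_nonneg _) hK0
        _ = K * (‖F y‖ * ‖fderiv ℝ F y e₂‖) := rfl
  have i_w : Integrable (fun y => deriv g (y 2) * ‖F y‖ ^ 2) volume := by
    refine (hF2.const_mul K).mono' ?_ (Eventually.of_forall fun y => ?_)
    · exact (((hg.continuous_deriv le_rfl).comp (PiLp.continuous_apply 2 _ (2 : Fin 3))).mul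
        (cF.norm.pow 2)).aestronglyMeasurable
    · rw [Real.norm_eq_abs, abs_mul, abs_of_nonneg (sq_nonneg ‖F y‖)]
      exact mul_le_mul_of_nonneg_right (hg'K _) (sq_nonneg _)
  have idiv : Integrable (fun y => VectorCalculus.divergence (fun z => (a z * n z) • e₂) y) volume := by
    have e : (fun y => VectorCalculus.divergence (fun z => (a z * n z) • e₂) y) =
        fun y => deriv g (y 2) * ‖F y‖ ^ 2 + 2 * (g (y 2) * ⟪F y, fderiv ℝ F y e₂⟫) := funext hdivY
    rw [e]; exact i_w.add (i_main.const_mul 2)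
  have h0 := integral_divergence_eq_zero_of_integrable hY1 iY idiv
  simp_rw [hdivY] at h0
  rw [integral_add i_w (i_main.const_mul 2), integral_const_mul] at h0
  linarith

/-- **Enstrophy form** of the axial rule: `∫ g(x₂)⟪ω, ∂₂ω⟫ = −½∫ g′(x₂)‖ω‖²` for `V ∈ C²` with `ω = curl V ∈ L²` and
`‖ω‖‖∂₂ω‖ ∈ L¹` — the first term of the enstrophy variation `a₁(φ_g)` along the slide (record §2). [folklore] -/
theorem integral_axialWeight_inner_fderiv_curl_eq (hV : ContDiff ℝ 2 V)
    (hZ : Integrable (fun x => ‖curl V x‖ ^ 2) volume)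
    (hZD : Integrable (fun x => ‖curl V x‖ * ‖fderiv ℝ (curl V) x (EuclideanSpace.single (2 : Fin 3) (1 : ℝ))‖) volume)
    (hg : ContDiff ℝ 1 g) {K : ℝ} (hgK : ∀ s, |g s| ≤ K) (hg'K : ∀ s, |deriv g s| ≤ K) :
    (∫ x, g (x 2) * ⟪curl V x, fderiv ℝ (curl V) x (EuclideanSpace.single (2 : Fin 3) (1 : ℝ))⟫) =
      -(1 / 2) * ∫ x, deriv g (x 2) * ‖curl V x‖ ^ 2 :=
  integral_axialWeight_inner_fderiv_eq (contDiff_curl (n := 1) (by exact_mod_cast hV)) hZ hZD hg hgK hg'K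

end ExtremiserLiouville

end Summit.NavierStokesRegularity.NavierStokesRegularity.Theorems

end
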